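import Mathlib
import HarnessLib
import HarnessLib.Audit
import Summits.CriticalPhenomena.PercolationContinuityZ3.Theorems.PercNearOneGluingNoHeavyLowerTailHexMSDelta

/-!
# HEX-MS reduces to its dense ('edge-poor') case (hp-7 gen 65)

Support file for crux `stmt-CriticalPhenomena-4575` (route `PercNearOneGluingNoHeavy`), hull-port seat `prim-hp-7` (generation 65);
`--supports stmt-CriticalPhenomena-4575`.  No `sorry`.  Memo: `run/shared/lean/prim/prim-hp-7/FROM-prim-hp-7-g65-REDUCTIONS.md` §0(1),(3).

Call an antipodal instance `(U, 𝒟, x)` **edge-poor** if in EVERY direction `r ∈ U` the generated family has fewer than half as many cube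
edges as the family: `2 · #(edgesAt (gen 𝒟 x) r) < #(twins 𝒟 r)`.  Using the coordinate reduction of the companion file
(`card_le_two_mul_card_gen_of_reduction`) in any direction that is not edge-poor, an induction on `#U + #𝒟` proves

* `hexMSRel_of_edgePoor` : HEX-MS (relative form, all ground sets) follows from HEX-MS for edge-poor instances alone;
* `hexMS_of_edgePoor` : the same for the g64 statement `HexMS`.

So Conjecture HEX-MS is equivalent to its restriction to edge-poor families.  Census (memo §3): at n = 4 the edge-poor labellings are exactly
13 032 labellings of the FULL cube `2^[4]`; at n = 5 / 6 edge-poor families have ≥ 11 of 16 / ≥ 20 of 32 antipodal pairs in all annealing runs;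
every edge-poor family found by annealing has a disjoint close pair, but 'α1' (families without a disjoint close pair are never edge-poor)
holds only for n ≤ 5 and FAILS at n = 6 by exact SAT (memo §0(3); kit j202070).  The dense regime is genuinely hard: there are edge-poor families on 6 points (27 of 32 pairs, surplus 1)
for which no single- or double-pair removal and no Marica–Schönheim batch certifies the count (memo §0(3)).
-/

namespace Summit.CriticalPhenomena.PercolationContinuityZ3.Theorems

namespace GeneratedDonors

open Finset

variable {α : Type*} [DecidableEq α]

section Statements

/-- An instance is **edge-poor** if in every direction of the ground set the generated family has fewer than half as many cube edges as
the family itself (so the coordinate reduction applies in no direction). -/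
def EdgePoor (U : Finset α) (𝒟 : Finset (Finset α)) (x : Finset α → ZMod 6) : Prop :=
  ∀ r ∈ U, 2 * #(edgesAt (gen 𝒟 x) r) < #(twins 𝒟 r)

/-- **HEX-MS for edge-poor instances** (the dense case of the conjecture; open): every edge-poor antipodal instance satisfies `HexMSRel`. -/
def HexMSEdgePoor : Prop :=
  ∀ (α : Type) [DecidableEq α] (U : Finset α) (𝒟 : Finset (Finset α)) (x : Finset α → ZMod 6),
    EdgePoor U 𝒟 x → HexMSRel U 𝒟 x

end Statements

section Architecture

/-- **Reduction to the dense case** (with an explicit size bound for the induction): HEX-MS for edge-poor instances implies HEX-MS. -/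
theorem hexMSRel_of_edgePoor_aux (hP : HexMSEdgePoor) :
    ∀ (γ : Type) [DecidableEq γ] (N : ℕ) (U : Finset γ) (𝒟 : Finset (Finset γ)) (x : Finset γ → ZMod 6),
      #U + #𝒟 ≤ N → HexMSRel U 𝒟 x := by
  intro γ _ N
  induction N with
  | zero =>
    intro U 𝒟 x hN _ _ _
    have : #𝒟 = 0 := by omega
    rw [card_eq_zero.mp this]; simp
  | succ N ih =>
    intro U 𝒟 x hN hU hco hanti
    classical
    -- trivial if 𝒟 is empty
    by_cases hD : 𝒟 = ∅
    · rw [hD]; simp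
    -- small families: the product ∅ = d \ d suffices
    by_cases hsmall : #𝒟 ≤ 2
    · obtain ⟨d, hd⟩ := nonempty_iff_ne_empty.mpr hD
      have : d \ d ∈ gen 𝒟 x := mem_gen.mpr ⟨d, hd, d, hd, Or.inl rfl, rfl⟩
      have : 0 < #(gen 𝒟 x) := card_pos.mpr ⟨_, this⟩
      omega
    -- Case A: a good direction
    by_cases hgood : ∃ r ∈ U, #(twins 𝒟 r) ≤ 2 * #(edgesAt (gen 𝒟 x) r)
    · obtain ⟨r, hr, hedge⟩ := hgood
      -- a half H of the twins under the complement-in-(U.erase r) involution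
      set σ : Finset γ → Finset γ := fun e => (U.erase r) \ e with hσ
      have hcl : ∀ s ∈ twins 𝒟 r, σ s ∈ twins 𝒟 r := fun s hs => compl_erase_mem_twins hr hco hs
      have hsubTw : ∀ s ∈ twins 𝒟 r, s ⊆ U.erase r := by
        intro s hs i hi
        obtain ⟨hsD, hrs, _⟩ := mem_twins.mp hs
        exact mem_erase.mpr ⟨fun h => hrs (h ▸ hi), hU s hsD hi⟩
      have hinv : ∀ s ∈ twins 𝒟 r, σ (σ s) = s := fun s hs => Finset.sdiff_sdiff_eq_self (hsubTw s hs)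
      have hfix : ∀ s ∈ twins 𝒟 r, σ s ≠ s := by
        intro s hs h
        obtain ⟨hsD, hrs, hins⟩ := mem_twins.mp hs
        -- s = (U.erase r) \ s forces s = ∅ and U.erase r = ∅, so every member lies in {r}: #𝒟 ≤ 2, excluded
        have hs0 : s = ∅ := by
          apply eq_empty_of_forall_notMem
          intro i hi
          have : i ∈ σ s := h.symm ▸ hi
          exact (mem_sdiff.mp this).2 hi
        have hUe : U.erase r = ∅ := by
          have : σ s = ∅ := by rw [h, hs0]
          simpa [hσ, hs0] using this
        have hsub1 : ∀ a ∈ 𝒟, a ⊆ {r} := by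
          intro a ha i hi
          rw [mem_singleton]
          by_contra hir
          have : i ∈ U.erase r := mem_erase.mpr ⟨hir, hU a ha hi⟩
          rw [hUe] at this
          exact notMem_empty i this
        have hDsub : 𝒟 ⊆ ({r} : Finset γ).powerset := fun a ha => mem_powerset.mpr (hsub1 a ha)
        have : #𝒟 ≤ 2 := by
          have := card_le_card hDsub
          rw [card_powerset, card_singleton] at this
          exact this
        omega
      obtain ⟨H, hHsub, hHfree, hHcov⟩ := exists_half_of_involution σ (twins 𝒟 r) hcl hinv hfix
      have hcardTw : #(twins 𝒟 r) = 2 * #H := card_eq_two_mul_card_half σ _ H hcl hinv hHsub hHfree hHcov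
      -- the r-free members and the reduction data
      set E : Finset (Finset γ) := 𝒟.filter fun e => r ∉ e with hE
      set E0 : Finset (Finset γ) := (E \ twins 𝒟 r) ∪ H with hE0
      have hTwE : twins 𝒟 r ⊆ E := fun s hs => by
        rw [hE, mem_filter]; exact ⟨(mem_twins.mp hs).1, (mem_twins.mp hs).2.1⟩
      have hRD : ReductionData U r 𝒟 E0 := by
        refine ⟨?_, ?_, ?_⟩
        · intro e he
          rw [hE0, mem_union, mem_sdiff] at he
          rcases he with ⟨he, _⟩ | he
          · exact (mem_filter.mp he).1
          · exact (mem_twins.mp (hHsub he)).1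
        · intro e he
          rw [hE0, mem_union, mem_sdiff] at he
          rcases he with ⟨he, _⟩ | he
          · exact (mem_filter.mp he).2
          · exact (mem_twins.mp (hHsub he)).2.1
        · intro e he hce
          rw [hE0, mem_union, mem_sdiff] at he hce
          -- if the complement (U.erase r) \ e is r-free and in 𝒟 then e is a twin
          have htw_of : ∀ f ∈ E, (U.erase r) \ f ∈ E → f ∈ twins 𝒟 r := by
            intro f hf hcf
            rw [hE, mem_filter] at hf hcf
            refine mem_twins.mpr ⟨hf.1, hf.2, ?_⟩
            have : U \ ((U.erase r) \ f) = insert r f := by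
              ext i
              simp only [mem_sdiff, mem_erase, mem_insert, not_and, not_not]
              constructor
              · rintro ⟨hiU, h2⟩
                by_cases hir : i = r
                · exact Or.inl hir
                · exact Or.inr (h2 ⟨hir, hiU⟩)
              · rintro (rfl | hif)
                · exact ⟨hr, fun h => absurd rfl h.1⟩
                · exact ⟨hU f hf.1 hif, fun _ => hif⟩
            rw [← this]; exact hco _ hcf.1
          rcases he with ⟨heE, henT⟩ | heH
          · -- e non-twin: its complement cannot be in E at all
            rcases hce with ⟨hcE, _⟩ | hcH
            · exact henT (htw_of e heE hcE)
            · have hcT := hHsub hcH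
              have : e ∈ twins 𝒟 r := by
                have := hcl _ hcT
                rwa [show σ ((U.erase r) \ e) = e from
                  Finset.sdiff_sdiff_eq_self (fun i hi => mem_erase.mpr
                    ⟨fun h => (mem_filter.mp heE).2 (h ▸ hi), hU e (mem_filter.mp heE).1 hi⟩)] at this
              exact henT this
          · rcases hce with ⟨_, hcnT⟩ | hcH
            · exact hcnT (hcl e (hHsub heH))
            · exact hHfree e heH hcH
      -- cardinalities: #𝒟 = 2 #E, #E0 = #E - #twins + #H, #twins = 2 #H
      have hcardD : #𝒟 = 2 * #E := card_eq_two_mul_card_rfree hr hU hco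
      have hcardE0 : #E0 + #H = #E := by
        have hdisj : Disjoint (E \ twins 𝒟 r) H := by
          rw [disjoint_left]; intro s hs hsH; exact (mem_sdiff.mp hs).2 (hHsub hsH)
        rw [hE0, card_union_of_disjoint hdisj, card_sdiff_of_subset hTwE, hcardTw]
        have : #(twins 𝒟 r) ≤ #E := card_le_card hTwE
        omega
      -- induction hypothesis for the reduced instance (ground set smaller by one)
      have hIH : HexMSRel (U.erase r) (reducedFamily U r E0) (reducedLabel U r E0 x) := by
        apply ih
        have h1 : #(U.erase r) < #U := card_erase_lt_of_mem hr
        have h2 : #(reducedFamily U r E0) = 2 * #E0 := card_reducedFamily hRD hU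
        omega
      apply card_le_two_mul_card_gen_of_reduction hRD hU hco hanti hIH
      omega
    -- Case B: every direction is edge-poor — the hypothesis applies
    · have hpoor : EdgePoor U 𝒟 x := fun r hr => by
        by_contra h
        exact hgood ⟨r, hr, by omega⟩
      exact hP γ U 𝒟 x hpoor hU hco hanti

/-- **HEX-MS reduces to its edge-poor (dense) case**, relative form. -/
theorem hexMSRel_of_edgePoor (hP : HexMSEdgePoor) {γ : Type} [DecidableEq γ] (U : Finset γ) (𝒟 : Finset (Finset γ))
    (x : Finset γ → ZMod 6) : HexMSRel U 𝒟 x :=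
  hexMSRel_of_edgePoor_aux hP γ (#U + #𝒟) U 𝒟 x le_rfl

/-- **HEX-MS reduces to its edge-poor (dense) case**: Conjecture HEX-MS of g64 (`HexMS`, all finite types) follows from `HexMSEdgePoor`. -/
theorem hexMS_of_edgePoor (hP : HexMSEdgePoor) : HexMS := by
  intro γ _ _ 𝒟 x
  classical
  exact (hexMSRel_univ_iff 𝒟 x).mp (hexMSRel_of_edgePoor hP univ 𝒟 x)

end Architecture

end GeneratedDonors

end Summit.CriticalPhenomena.PercolationContinuityZ3.Theorems
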